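import Literature.NumberTheory.PAdicHodge.FontaineThetaKernel
import Literature.NumberTheory.PAdicHodge.FontaineThetaGalois
import Mathlib.Topology.Algebra.OpenSubgroup
import Mathlib.FieldTheory.KrullTopology
import Mathlib.RingTheory.WittVector.Domain
import Mathlib.RingTheory.WittVector.Truncated
import HarnessLib

/-!
# Continuity of the `Γ_F`-action on `𝔸_inf(F) = 𝕎(𝒪_{ℂ_F}♭)` for the `(p, ξ)`-adic topology

Topic `Literature/NumberTheory/PAdicHodge`; THEOREMS ONLY (no definition, no named fact, no instance,
no `sorry`). For a `p`-adic field `F` the absolute Galois group `Γ_F` acts on `𝒪_{ℂ_F}`, on the tilt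
`𝒪_{ℂ_F}♭` and on `𝔸_inf(F) = 𝕎(𝒪_{ℂ_F}♭)` (tree `FontaineThetaGalois`: `galInt`, `galTilt`, `galAinf`).
Fontaine (*Le corps des périodes p-adiques*, Exp. II §1.3–1.5) topologises `𝔸_inf` by the
`(p, [ϖ])`-adic (= `(p, ξ)`-adic, `ξ = [p♭] − p`) topology and remarks that the action of `Γ_F` is
continuous; Kato (LNM 1553, II §1.2.5) uses the induced topology on `B_dR⁺/Fil^n`. This file proves the
continuity statement in the GROUP variable, in the elementary def-free form

* `exists_openSubgroup_galAinf_sub_mem_span` (**main**): for every `a ∈ 𝔸_inf(F)` and `N k : ℕ` there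
  is an open subgroup `U ≤ Γ_F` with `τ a − a ∈ (ξ^k, p^N)` for all `τ ∈ U`,

i.e. `τ ↦ τ a` is continuous from the Krull topology to the `(p, ξ)`-adic topology. Steps:
`𝒪_{ℂ_F}`-level (§1: `τ s ≡ s mod p` on the stabiliser of an algebraic approximation of `s`, density of
`F̄` in `ℂ_F` and isometry of the action), tilt level (§2: finitely many coefficients of `τ t` and `t` in
`𝒪_{ℂ_F}/p` agree on an open subgroup), Witt-vector level (§3: finitely many Witt coefficients), and an
ideal-theoretic comparison (§4): a Witt vector whose first `N` coefficients have vanishing `(j+N)`-th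
tilt coefficient lies in `([p♭]^{p^j}, p^N)` — by the decomposition `x = [x₀] + V(x₁, x₂, …)`,
`V = p φ⁻¹` on `𝕎` of a perfect ring, and `ker(y ↦ y_j) = (p♭)^{p^j} 𝒪♭` (tree `divPFlat`) — together
with `[p♭] = ξ + p`, so `[p♭]^{N+k} ∈ (ξ^k, p^N)` (§5).

## References
* J.-M. Fontaine, *Le corps des périodes p-adiques*, Astérisque 223 (1994), Exp. II §1.3–1.5. [FontaineAsterisque223III]
* K. Kato, LNM 1553 (1993), Ch. II §1.2.5. [Kato1993LNM1553]
* J.-M. Fontaine, Y. Ouyang, *Theory of p-adic Galois representations*, §4.4. [FontaineOuyang2022]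
-/

noncomputable section

open ValuativeRel Field Ideal WittVector Topology

namespace Literature.NumberTheory.PAdicHodge

open Literature.NumberTheory.GaloisRepresentations
open Literature.NumberTheory.GaloisRepresentations.IsNonarchimedeanLocalField

namespace GaloisContinuity

variable {F : Type} [Field F] [ValuativeRel F] [TopologicalSpace F] [IsNonarchimedeanLocalField F]
  {p : ℕ}

/-! ## §1 `𝒪_{ℂ_F}`: `τ s ≡ s (mod p)` on an open subgroup -/

/-- The stabiliser in `Γ_F` of an element of `F̄` is open (Krull topology). [folklore] -/
private theorem isOpen_stabilizer (y : NormedAlgClosure F) :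
    IsOpen (MulAction.stabilizer (absoluteGaloisGroup F) y : Set (absoluteGaloisGroup F)) :=
  stabilizer_isOpen_of_isIntegral (K := F) (L := AlgebraicClosure F) (NormedAlgClosure.toAlgClosure y)

/-- **Continuity of `Γ_F` on `𝒪_{ℂ_F}` modulo a fixed element**: for `s ∈ 𝒪_{ℂ_F}` and `u ∈ 𝒪_{ℂ_F}`,
`u ≠ 0`, there is an open subgroup `U ≤ Γ_F` with `τ s − s ∈ (u)` for all `τ ∈ U` — approximate `s` by an
algebraic `y` within `‖u‖` (density of `F̄` in `ℂ_F`) and take the stabiliser of `y`; the action is isometric.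
[cite: FontaineAsterisque223III, Exp. II §1.3 (continuité de l'action de G_K)] [cite: FontaineOuyang2022, §3.1] -/
theorem exists_openSubgroup_galInt_sub_mem_span (s u : integerC F) (hu : (u : CompletedAlgClosure F) ≠ 0) :
    ∃ U : OpenSubgroup (absoluteGaloisGroup F), ∀ τ ∈ U, galInt τ s - s ∈ Ideal.span {u} := by
  have hpos : 0 < ‖(u : CompletedAlgClosure F)‖ := norm_pos_iff.mpr hu
  obtain ⟨y, hy⟩ := (CompletedAlgClosure.denseRange_coe (F := F)).exists_dist_lt (s : CompletedAlgClosure F) hpos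
  rw [dist_eq_norm] at hy
  refine ⟨⟨MulAction.stabilizer (absoluteGaloisGroup F) y, isOpen_stabilizer y⟩, fun τ hτ => ?_⟩
  have hτy : τ • y = y := MulAction.mem_stabilizer_iff.mp hτ
  rw [← pow_one (Ideal.span {u}), mem_span_pow_iff hu 1, pow_one]
  have h1 : ((galInt τ s - s : integerC F) : CompletedAlgClosure F) =
      τ • ((s : CompletedAlgClosure F) - y) - ((s : CompletedAlgClosure F) - y) := by
    rw [AddSubgroupClass.coe_sub, coe_galInt, smul_sub, CompletedAlgClosure.smul_coe τ y, hτy]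
    ring
  rw [h1, sub_eq_add_neg]
  refine (IsUltrametricDist.norm_add_le_max _ _).trans ?_
  rw [norm_neg, CompletedAlgClosure.norm_smul, max_self]
  exact hy.le

/-! ## §2 The tilt: finitely many coefficients are fixed on an open subgroup -/

variable [Fact p.Prime] [Fact (¬ IsUnit (p : integerC F))]

/-- **Continuity of `Γ_F` on `𝒪_{ℂ_F}♭`**: for `t ∈ 𝒪_{ℂ_F}♭` and `j`, the `j`-th coefficient of `τ t` in
`𝒪_{ℂ_F}/p` equals that of `t` for all `τ` in an open subgroup (apply §1 to a lift of `t_j` with `u = p`).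
[cite: FontaineAsterisque223III, Exp. II §1.3] -/
theorem exists_openSubgroup_coeff_galTilt_eq (hp0 : (p : CompletedAlgClosure F) ≠ 0)
    (t : PreTilt (integerC F) p) (j : ℕ) :
    ∃ U : OpenSubgroup (absoluteGaloisGroup F), ∀ τ ∈ U, PreTilt.coeff j (galTilt τ t) = PreTilt.coeff j t := by
  obtain ⟨s, hs⟩ := Ideal.Quotient.mk_surjective (PreTilt.coeff j t)
  obtain ⟨U, hU⟩ := exists_openSubgroup_galInt_sub_mem_span s (p : integerC F)
    (by rw [coe_natCast_integerC]; exact hp0)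
  refine ⟨U, fun τ hτ => ?_⟩
  rw [coeff_galTilt, ← hs, galModP_mk, Ideal.Quotient.eq]
  exact hU τ hτ

/-- Finitely many coefficients at once: for `t : Fin n → 𝒪_{ℂ_F}♭` and `j`, one open subgroup fixes all the
`j`-th coefficients. [cite: FontaineAsterisque223III, Exp. II §1.3] -/
theorem exists_openSubgroup_forall_coeff_galTilt_eq (hp0 : (p : CompletedAlgClosure F) ≠ 0) {n : ℕ}
    (t : Fin n → PreTilt (integerC F) p) (j : ℕ) :
    ∃ U : OpenSubgroup (absoluteGaloisGroup F), ∀ τ ∈ U, ∀ i,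
      PreTilt.coeff j (galTilt τ (t i)) = PreTilt.coeff j (t i) := by
  classical
  choose U hU using fun i => exists_openSubgroup_coeff_galTilt_eq hp0 (t i) j
  refine ⟨Finset.univ.inf U, fun τ hτ i => hU i τ ?_⟩
  exact (Finset.inf_le (Finset.mem_univ i) : Finset.univ.inf U ≤ U i) hτ

/-! ## §3 Witt vectors: the first `N` coefficients, read in `𝒪_{ℂ_F}/p` at depth `j`, are fixed -/

/-- **Continuity of `Γ_F` on `𝔸_inf(F)`, coefficient form**: for `a ∈ 𝕎(𝒪_{ℂ_F}♭)`, `N` and `j` there is an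
open subgroup `U` such that for `τ ∈ U` the Witt vector `τ a − a` has its first `N` coefficients in
`ker(y ↦ y_j) ⊆ 𝒪_{ℂ_F}♭` (apply the ring map `𝕎(y ↦ y_j)` and truncate). [cite: FontaineAsterisque223III, Exp. II §1.3] -/
theorem exists_openSubgroup_coeff_galAinf_sub (hp0 : (p : CompletedAlgClosure F) ≠ 0)
    (a : Ainf (p := p) F) (N j : ℕ) :
    ∃ U : OpenSubgroup (absoluteGaloisGroup F), ∀ τ ∈ U, ∀ i < N,
      PreTilt.coeff j ((galAinf τ a - a).coeff i) = 0 := by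
  obtain ⟨U, hU⟩ := exists_openSubgroup_forall_coeff_galTilt_eq hp0 (fun i : Fin N => a.coeff i) j
  refine ⟨U, fun τ hτ i hi => ?_⟩
  -- the ring map `Φ = truncate_N ∘ 𝕎(coeff j)`
  let Ψ : Ainf (p := p) F →+* WittVector p (ModP (integerC F) p) := WittVector.map (PreTilt.coeff j)
  have hΨ : ∀ (x : Ainf (p := p) F) (m : ℕ), (Ψ x).coeff m = PreTilt.coeff j (x.coeff m) :=
    fun x m => WittVector.map_coeff _ _ _
  have htr : WittVector.truncate N (Ψ (galAinf τ a)) = WittVector.truncate N (Ψ a) := by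
    refine TruncatedWittVector.ext fun m => ?_
    rw [WittVector.coeff_truncate, WittVector.coeff_truncate, hΨ, hΨ, coeff_galAinf]
    exact hU τ hτ m
  have hker : Ψ (galAinf τ a - a) ∈ RingHom.ker (WittVector.truncate (p := p) N) := by
    rw [RingHom.mem_ker, map_sub, map_sub, htr, sub_self]
  rw [WittVector.mem_ker_truncate] at hker
  rw [← hΨ]
  exact hker i hi

/-! ## §4 The ideal lemma: small first coefficients ⇒ `x ∈ ([p♭]^{p^j}, p^N)` -/

/-- `ker(y ↦ y_j) = (p♭)^{p^j} 𝒪_{ℂ_F}♭`: if the `j`-th coefficient of `y` vanishes then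
`y = (p♭)^{p^j} · w` (`φ^{-j} y` has vanishing `0`-th coefficient, so is `p♭ · w₀` by the tree's `divPFlat`;
apply `φ^j`). [cite: FontaineAsterisque223III, Exp. II §1.2.2] [cite: FontaineOuyang2022, Prop. 4.3.3] -/
theorem exists_eq_pFlat_pow_mul_of_coeff_eq_zero [IsAdicComplete (Ideal.span {(p : integerC F)}) (integerC F)]
    [CharZero F] {y : PreTilt (integerC F) p} {j : ℕ} (hy : PreTilt.coeff j y = 0) :
    ∃ w : PreTilt (integerC F) p, y = pFlat ^ p ^ j * w := by
  -- `y' = φ^{-j} y` has `y'_0 = y_j = 0`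
  set y' : PreTilt (integerC F) p := ((frobeniusEquiv (PreTilt (integerC F) p) p).symm^[j]) y with hy'
  have hy'0 : PreTilt.coeff 0 y' = 0 := by
    rw [hy', PreTilt.coeff_iterate_frobeniusEquiv_symm, zero_add, hy]
  obtain ⟨w₀, hw₀⟩ := exists_eq_pFlat_mul_of_coeff_zero_eq_zero hy'0
  refine ⟨(frobenius (PreTilt (integerC F) p) p)^[j] w₀, ?_⟩
  have hyy' : y = (frobenius (PreTilt (integerC F) p) p)^[j] y' := by
    rw [hy']
    exact ((Function.LeftInverse.iterate (frobenius_apply_frobeniusEquiv_symm (PreTilt (integerC F) p) p)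
      j) y).symm
  rw [hyy', hw₀, ← RingHom.coe_pow, map_mul, RingHom.coe_pow, iterate_frobenius]

/-- `V z = φ⁻¹(z) · p` on `𝕎` of the perfect ring `𝒪_{ℂ_F}♭`, with the coefficients of `φ⁻¹ z` being the
`p`-th roots of those of `z`. [folklore] -/
private theorem verschiebung_eq_frobeniusEquiv_symm_mul (z : Ainf (p := p) F) :
    verschiebung z = (WittVector.frobeniusEquiv p (PreTilt (integerC F) p)).symm z * (p : Ainf (p := p) F) ∧
      ∀ i, ((WittVector.frobeniusEquiv p (PreTilt (integerC F) p)).symm z).coeff i =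
        (frobeniusEquiv (PreTilt (integerC F) p) p).symm (z.coeff i) := by
  set z' := (WittVector.frobeniusEquiv p (PreTilt (integerC F) p)).symm z with hz'
  refine ⟨?_, fun i => ?_⟩
  · have hz : z = frobenius z' := by
      rw [hz', ← WittVector.frobeniusEquiv_apply, RingEquiv.apply_symm_apply]
    rw [hz, verschiebung_frobenius]
  · rw [hz', WittVector.frobeniusEquiv_symm_apply, WittVector.map_coeff]
    rfl

/-- `x = [x₀] + x'` with `x'₀ = 0` and `x'_i = x_i` for `i ≥ 1` (`x' := x − [x₀]`; the supports of `x'` and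
`[x₀]` are disjoint, Mathlib `WittVector.coeff_add_of_disjoint`). [folklore] -/
private theorem coeff_sub_teichmuller (x : Ainf (p := p) F) :
    (x - teichmuller p (x.coeff 0)).coeff 0 = 0 ∧
      ∀ i, 0 < i → (x - teichmuller p (x.coeff 0)).coeff i = x.coeff i := by
  have h0 : (x - teichmuller p (x.coeff 0)).coeff 0 = 0 := by
    rw [← constantCoeff_apply, map_sub, constantCoeff_apply, constantCoeff_apply, teichmuller_coeff_zero,
      sub_self]
  refine ⟨h0, fun i hi => ?_⟩
  have hdisj : ∀ n, (x - teichmuller p (x.coeff 0)).coeff n = 0 ∨ (teichmuller p (x.coeff 0)).coeff n = 0 := by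
    intro n
    rcases Nat.eq_zero_or_pos n with rfl | hn
    · exact Or.inl h0
    · exact Or.inr (teichmuller_coeff_pos p _ n hn)
  have h := coeff_add_of_disjoint i (x - teichmuller p (x.coeff 0)) (teichmuller p (x.coeff 0)) hdisj
  rw [sub_add_cancel, teichmuller_coeff_pos p _ i hi, add_zero] at h
  exact h.symm

/-- **The ideal lemma.** If the first `N` Witt coefficients of `x ∈ 𝕎(𝒪_{ℂ_F}♭)` have vanishing
`(j+N)`-th tilt coefficient, then `x ∈ ([p♭]^{p^j}, p^N)`. Induction on `N`: `x = [x₀] + V(z)`,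
`[x₀] ∈ ([p♭]^{p^{j+N}})` by `ker(y ↦ y_{j+N}) = (p♭)^{p^{j+N}}`, `V(z) = p · φ⁻¹(z)` and the coefficients of
`φ⁻¹(z)` — `p`-th roots of `x₁, x₂, …` — have vanishing `(j+N−1)`-th coefficient.
[cite: FontaineAsterisque223III, Exp. II §1.3 (topologie de A_inf)] [cite: FontaineOuyang2022, §4.4] -/
theorem mem_span_of_forall_coeff_coeff_eq_zero [IsAdicComplete (Ideal.span {(p : integerC F)}) (integerC F)]
    [CharZero F] (N j : ℕ) (x : Ainf (p := p) F) (hx : ∀ i < N, PreTilt.coeff (j + N) (x.coeff i) = 0) :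
    x ∈ Ideal.span {teichmuller p pFlat ^ p ^ j, (p : Ainf (p := p) F) ^ N} := by
  induction N generalizing x with
  | zero => exact Ideal.mem_span_pair.2 ⟨0, x, by rw [pow_zero, zero_mul, zero_add, mul_one]⟩
  | succ N ih =>
    -- `x₀ = (p♭)^{p^{j+N+1}} w`
    obtain ⟨w, hw⟩ := exists_eq_pFlat_pow_mul_of_coeff_eq_zero (hx 0 (Nat.succ_pos N))
    -- `x' = x − [x₀] = V z`, `V z = z' p`
    obtain ⟨hx'0, hx'i⟩ := coeff_sub_teichmuller x
    set x' := x - teichmuller p (x.coeff 0) with hx'def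
    have hV : x' = verschiebung (x'.shift 1) := by
      have h := eq_iterate_verschiebung (x := x') (n := 1) (fun i hi => by
        obtain rfl : i = 0 := Nat.lt_one_iff.mp hi
        exact hx'0)
      simpa only [Function.iterate_one] using h
    obtain ⟨hVz, hzc⟩ := verschiebung_eq_frobeniusEquiv_symm_mul (x'.shift 1)
    set z' := (WittVector.frobeniusEquiv p (PreTilt (integerC F) p)).symm (x'.shift 1) with hz'def
    -- coefficients of `z'`
    have hz' : ∀ i < N, PreTilt.coeff (j + N) (z'.coeff i) = 0 := by
      intro i hi
      rw [hzc i, PreTilt.coeff_frobeniusEquiv_symm, shift_coeff, hx'i (1 + i) (by omega)]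
      have h := hx (1 + i) (by omega)
      rwa [show j + (N + 1) = j + N + 1 by ring] at h
    obtain ⟨c, d, hcd⟩ := Ideal.mem_span_pair.1 (ih z' hz')
    -- assemble
    have hx_eq : x = teichmuller p pFlat ^ p ^ (j + (N + 1)) * teichmuller p w + z' * (p : Ainf (p := p) F) := by
      calc x = x' + teichmuller p (x.coeff 0) := (sub_add_cancel _ _).symm
        _ = z' * (p : Ainf (p := p) F) + teichmuller p (pFlat ^ p ^ (j + (N + 1)) * w) := by rw [← hVz, ← hV, hw]
        _ = _ := by rw [map_mul, map_pow]; ring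
    have hdvd : teichmuller p (pFlat : PreTilt (integerC F) p) ^ p ^ j ∣
        teichmuller p pFlat ^ p ^ (j + (N + 1)) := by
      rw [pow_add p j (N + 1), pow_mul]
      exact dvd_pow_self _ (pow_ne_zero _ (Fact.out : p.Prime).ne_zero)
    obtain ⟨e, he⟩ := hdvd
    refine Ideal.mem_span_pair.2 ⟨e * teichmuller p w + c * (p : Ainf (p := p) F), d, ?_⟩
    rw [hx_eq, he, ← hcd]
    ring

/-! ## §5 From `[p♭]` to `ξ = [p♭] − p`, and the main theorem -/

omit [Fact p.Prime] [Fact (¬ IsUnit (p : integerC F))] in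
/-- `(a + b)^{k+n} ∈ (a^k, b^n)` in any commutative ring (binomial theorem). [folklore] -/
private theorem add_pow_add_mem_span_pair {R : Type*} [CommRing R] (a b : R) (k n : ℕ) :
    (a + b) ^ (k + n) ∈ Ideal.span {a ^ k, b ^ n} := by
  rw [add_pow]
  refine Ideal.sum_mem _ fun i hi => ?_
  rw [Finset.mem_range] at hi
  by_cases hik : k ≤ i
  · obtain ⟨m, rfl⟩ := Nat.exists_eq_add_of_le hik
    refine Ideal.mul_mem_right _ _ (Ideal.mul_mem_right _ _ ?_)
    rw [pow_add]
    exact Ideal.mul_mem_right _ _ (Ideal.subset_span (by simp))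
  · have hle : n ≤ k + n - i := by omega
    obtain ⟨m, hm⟩ := Nat.exists_eq_add_of_le hle
    refine Ideal.mul_mem_right _ _ (Ideal.mul_mem_left _ _ ?_)
    rw [hm, pow_add]
    exact Ideal.mul_mem_right _ _ (Ideal.subset_span (by simp))

/-- `([p♭]^{p^j}, p^N) ⊆ (ξ^k, p^N)` as soon as `k + N ≤ p^j` (`[p♭] = ξ + p`). [folklore] -/
private theorem span_teichmuller_pow_le_span_xi_pow {N k j : ℕ} (hj : k + N ≤ p ^ j) :
    Ideal.span {teichmuller p pFlat ^ p ^ j, (p : Ainf (p := p) F) ^ N} ≤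
      Ideal.span {(xi : Ainf (p := p) F) ^ k, (p : Ainf (p := p) F) ^ N} := by
  rw [Ideal.span_le]
  rintro y hy
  simp only [Set.mem_insert_iff, Set.mem_singleton_iff] at hy
  rcases hy with rfl | rfl
  · have hT : teichmuller p (pFlat : PreTilt (integerC F) p) = xi + (p : Ainf (p := p) F) := by rw [xi_def, sub_add_cancel]
    obtain ⟨m, hm⟩ := Nat.exists_eq_add_of_le hj
    rw [SetLike.mem_coe, hT, hm, pow_add]
    exact Ideal.mul_mem_right _ _ (add_pow_add_mem_span_pair _ _ k N)
  · exact Ideal.subset_span (by simp)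

/-- **Continuity of the `Γ_F`-action on `𝔸_inf(F)` for the `(p, ξ)`-adic topology (in the group variable).**
For every `a ∈ 𝔸_inf(F) = 𝕎(𝒪_{ℂ_F}♭)` and `N k : ℕ` there is an open subgroup `U ≤ Γ_F` (Krull topology)
such that `τ a − a ∈ (ξ^k, p^N)` for all `τ ∈ U`. Fontaine topologises `A_inf = W(R)` by the product of the
valuation topologies (equivalently the `(p, [ϖ])`-adic topology) and the action of `G_K` is continuous; this
is the form used by Kato (II §1.2.5) to topologise `B_dR⁺/Fil^n = (𝔸_inf/ξ^n)[1/p]`.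
[cite: FontaineAsterisque223III, Exp. II §1.3–1.5] [cite: Kato1993LNM1553, Ch. II §1.2.5] -/
theorem exists_openSubgroup_galAinf_sub_mem_span [IsAdicComplete (Ideal.span {(p : integerC F)}) (integerC F)]
    [CharZero F] (a : Ainf (p := p) F) (N k : ℕ) :
    ∃ U : OpenSubgroup (absoluteGaloisGroup F), ∀ τ ∈ U,
      galAinf τ a - a ∈ Ideal.span {(xi : Ainf (p := p) F) ^ k, (p : Ainf (p := p) F) ^ N} := by
  have hp0 : (p : CompletedAlgClosure F) ≠ 0 := natCast_C_ne_zero (Fact.out : p.Prime).ne_zero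
  -- depth `j` with `k + N ≤ p^j`
  obtain ⟨j, hj⟩ : ∃ j : ℕ, k + N ≤ p ^ j := ⟨k + N, (Nat.lt_pow_self (Fact.out : p.Prime).one_lt).le⟩
  obtain ⟨U, hU⟩ := exists_openSubgroup_coeff_galAinf_sub hp0 a N (j + N)
  exact ⟨U, fun τ hτ => span_teichmuller_pow_le_span_xi_pow hj
    (mem_span_of_forall_coeff_coeff_eq_zero N j _ (hU τ hτ))⟩

/-- The same for `σ • a` (the `MulSemiringAction` of `Γ_F` on `𝔸_inf(F)`). [cite: FontaineAsterisque223III, Exp. II §1.3–1.5] -/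
theorem exists_openSubgroup_smul_sub_mem_span [IsAdicComplete (Ideal.span {(p : integerC F)}) (integerC F)]
    [CharZero F] (a : Ainf (p := p) F) (N k : ℕ) :
    ∃ U : OpenSubgroup (absoluteGaloisGroup F), ∀ τ ∈ U,
      τ • a - a ∈ Ideal.span {(xi : Ainf (p := p) F) ^ k, (p : Ainf (p := p) F) ^ N} :=
  exists_openSubgroup_galAinf_sub_mem_span a N k

end GaloisContinuity

end Literature.NumberTheory.PAdicHodge

end
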